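import Mathlib
import HarnessLib
import Literature.Analysis.FluidPDE.VorticityCalculus
import Summits.NavierStokesRegularity.NavierStokesRegularity.Theses.LoopPeriodRatchet
import Summits.NavierStokesRegularity.NavierStokesRegularity.Theorems.PoloidalWindowDoorPoloidalWindowRigidityWindow
import Summits.NavierStokesRegularity.NavierStokesRegularity.Theorems.PoloidalWindowDoorPoloidalWindowRigidityHotLoopsReduction
import Summits.NavierStokesRegularity.NavierStokesRegularity.Theorems.PoloidalWindowDoorPoloidalWindowRigidityDiscDichotomy
import Summits.NavierStokesRegularity.NavierStokesRegularity.Theorems.PoloidalWindowDoorPoloidalWindowRigidityLayeredNoLoop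
import Summits.NavierStokesRegularity.NavierStokesRegularity.Theorems.PoloidalWindowDoorPoloidalWindowRigidityLoopsPersist
import Summits.NavierStokesRegularity.NavierStokesRegularity.Theorems.PoloidalWindowDoorPoloidalWindowRigidityJordanOrbit

/-!
# Route `PoloidalWindowDoor`, crux `PoloidalWindowRigidity` (K2, stmt-NavierStokesRegularity-19708) — LINE 14 `loop_island` (ns-idea-8 g7)
# COMPOSED IN THE KERNEL, SORRY-FREE: **the wall ⟨27893⟩ `LoopPeriodRatchet.FrequencyGrowthExponent` IS A SCALAR WALL —
# `FrequencyGrowthExponent ↔ NoIslands`**, and per profile PEAKLESS ⇒ LOOP-FREE (`noLoops_of_noIslands`)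

Cell ns-regularity-ideate, seat ns-poloidal-K2-p2 g12 (stub-worker on K2; `--supports` the crux item).  The line's four own stubs are tree
theorems (J `…JordanOrbit.stub_jordanOrbit`, D `…DiscDichotomy.stub_discDichotomy`, Z `…LoopsPersist.stub_loopsPersist`,
Y `…LayeredNoLoop.stub_layeredNoLoop`, all K2-p2 g12), so the line's compositions hold UNCONDITIONALLY; this file states them with the
line's `NoLoops` / `NoIslands` written out (bodies VERBATIM `Cruxes/PoloidalWindowRigidity/Lines/loop_island.lean` ad8f96e88fc9; a Theorems
file cannot import the Cruxes workfile):

* `noLoops_of_noIslands` — «NoIslands → NoLoops»: a class e₃-poloidal Type-I ancient mild profile with NO island bracket of `±v₂` on any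
  horizontal plane at any time carries NO non-stationary closed vortex line (Z: loops persist to nearby planes; J + D: on each, an island
  bracket or a `v₂`-flat plane; NoIslands kills islands through `v ≡ 0`; Y: a flat slab makes the original loop stationary);
* `frequencyGrowthExponent_of_noLoops` — the vacuous direction of `Lines/noloops_wall.lean` (`A := 1`, `κ := 0`);
* `noIslands_of_frequencyGrowthExponent` — IS the landed `…HotLoopsReduction.zero_of_island` (K2-p2 g11);
* `frequencyGrowthExponent_iff_noIslands`, `noLoops_iff_noIslands`.

Reading for the W4 wall board and for `cdisprove-27893`: item 27893 is EQUIVALENT, in the kernel, to «every class e₃-poloidal Type-I ancient mild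
profile with a planar strict-extremal compact set of `v₂` (an island bracket, either sign, any plane, any time) is `≡ 0`» — a statement about
ONE SCALAR; the two negation doors W_loop / W_peak are one door.  WHAT THIS IS NOT: not a claim about Navier–Stokes regularity; nothing here
proves or refutes 27893 / 19708 / 20428 / 22881 — all OPEN; bears_on LADDER-NS N0, rung N0-LocalTubeDoorPoloidal.
-/

noncomputable section

-- the summit and its single sub-problem share the name (CONVENTIONS §1), as in every Theorems file
set_option linter.dupNamespace false

namespace Summit.NavierStokesRegularity.NavierStokesRegularity.Theorems.PoloidalWindowDoorPoloidalWindowRigidityLoopIslandReduction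

open Set Function
open scoped InnerProductSpace RealInnerProductSpace
open Literature.Analysis Literature.Analysis.FluidPDE
open Summit.NavierStokesRegularity.NavierStokesRegularity.Theses.LoopPeriodRatchet
open Summit.NavierStokesRegularity.NavierStokesRegularity.Theorems

/-- **PEAKLESS ⇒ LOOP-FREE, per profile, unconditionally** (`NoIslands → NoLoops` of LINE 14, composed over the landed J, D, Z, Y). -/
theorem noLoops_of_noIslands
    (hNI :
    ∀ (C : ℝ) (v : ℝ → EuclideanSpace ℝ (Fin 3) → EuclideanSpace ℝ (Fin 3)),
      Literature.Analysis.FluidPDE.HasTypeITimeDecay C v →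
      ContinuousOn (Function.uncurry v) (Set.Iio (0 : ℝ) ×ˢ Set.univ) →
      (∀ s t : ℝ, s < t → t < 0 → ∀ x, v t x =
        Literature.Analysis.UnboundedOperators.heatExtension (v s) (t - s) x -
          Literature.Analysis.FluidPDE.oseenDuhamel 1 s v v t x) →
      (∀ t < 0, Literature.Analysis.FluidPDE.VectorCalculus.IsDivFree (v t)) →
      (∀ s < 0, ∀ y, ⟪Literature.Analysis.FluidPDE.curl (v s) y, EuclideanSpace.single 2 1⟫_ℝ = 0) →
      ∀ (s₀ z₁ σ M : ℝ) (K O : Set (EuclideanSpace ℝ (Fin 3))), s₀ < 0 →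
        ((σ = 1 ∨ σ = -1) ∧ IsCompact K ∧ K.Nonempty ∧ (∀ y ∈ K, y 2 = z₁ ∧ σ * v s₀ y 2 = M) ∧
          IsOpen O ∧ K ⊆ O ∧ (∀ y ∈ O, y 2 = z₁ → σ * v s₀ y 2 ≤ M) ∧
          (∀ y ∈ O, y 2 = z₁ → σ * v s₀ y 2 = M → y ∈ K)) →
        ∀ t < 0, ∀ x, v t x = 0) :
    ∀ (C : ℝ) (v : ℝ → EuclideanSpace ℝ (Fin 3) → EuclideanSpace ℝ (Fin 3)), Literature.Analysis.FluidPDE.HasTypeITimeDecay C v →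
      ContinuousOn (Function.uncurry v) (Set.Iio (0 : ℝ) ×ˢ Set.univ) →
      (∀ s t : ℝ, s < t → t < 0 → ∀ x, v t x = Literature.Analysis.UnboundedOperators.heatExtension (v s) (t - s) x -
        Literature.Analysis.FluidPDE.oseenDuhamel 1 s v v t x) →
      (∀ t < 0, Literature.Analysis.FluidPDE.VectorCalculus.IsDivFree (v t)) →
      (∀ s < 0, ∀ y, ⟪Literature.Analysis.FluidPDE.curl (v s) y, EuclideanSpace.single 2 1⟫_ℝ = 0) →
      ∀ s : ℝ, s < 0 → ∀ (γ : ℝ → EuclideanSpace ℝ (Fin 3)) (ℓ : ℝ), 0 < ℓ →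
        (∀ θ, HasDerivAt γ (Literature.Analysis.FluidPDE.curl (v s) (γ θ)) θ) → (∀ θ, γ (θ + ℓ) = γ θ) →
        Literature.Analysis.FluidPDE.curl (v s) (γ 0) = 0 := by
  intro C v hrate hcont hmild hdiv hpol s hs γ ℓ hℓ hγ hper
  by_contra hne
  obtain ⟨δ, hδ, hZ⟩ :=
    PoloidalWindowDoorPoloidalWindowRigidityLoopsPersist.stub_loopsPersist C v hrate hcont hmild hdiv hpol s hs γ ℓ hℓ hγ hper hne
  -- `C¹`-regularity and horizontality of `curl v(s)`
  have hA : IsTypeIAncientMild C v :=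
    PoloidalWindowDoorPoloidalWindowRigidityWindow.isTypeIAncientMild_of_class hrate hcont hmild hdiv
  have hvs : ContDiff ℝ (⊤ : ℕ∞) (v s) := hA.contDiff_slice hs
  have hV2 : ContDiff ℝ 2 (v s) := contDiff_infty.1 hvs 2
  have hX : ContDiff ℝ 1 (curl (v s)) := contDiff_curl (n := 1) (by exact_mod_cast hV2)
  have hX2 : ∀ y, curl (v s) y 2 = 0 := fun y => by
    simpa [EuclideanSpace.inner_single_right] using hpol s hs y
  have hflat : ∀ z : ℝ, |z - γ 0 2| < δ → ∃ c : ℝ, ∀ y : EuclideanSpace ℝ (Fin 3), y 2 = z → v s y 2 = c := by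
    intro z hz
    obtain ⟨γ', ℓ', hℓ', hγ', hper', hz', hne'⟩ := hZ z hz
    obtain ⟨O, hO, hbdd, hneO, hfr⟩ :=
      PoloidalWindowDoorPoloidalWindowRigidityJordanOrbit.stub_jordanOrbit (curl (v s)) hX hX2 γ' ℓ' hℓ' hγ' hper' hne'
    rcases PoloidalWindowDoorPoloidalWindowRigidityDiscDichotomy.stub_discDichotomy C v hrate hcont hmild hdiv hpol s hs γ' ℓ' hℓ' hγ'
        hper' hne' O hO hbdd hneO hfr with ⟨σ, M, K, O', hisl⟩ | hconst
    · exfalso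
      have hzero := hNI C v hrate hcont hmild hdiv hpol s (γ' 0 2) σ M K O' hs hisl
      have hvs0 : v s = 0 := by
        funext x
        exact hzero s hs x
      apply hne'
      rw [hvs0]
      exact curl_zero _
    · exact ⟨v s (γ' 0) 2, fun y hy => hconst y (by rw [hy, hz'])⟩
  exact hne (PoloidalWindowDoorPoloidalWindowRigidityLayeredNoLoop.stub_layeredNoLoop C v hrate hcont hmild hdiv hpol s hs
    ⟨γ 0 2, δ, hδ, hflat⟩ γ ℓ hℓ hγ hper)

/-- NoLoops ⇒ ⟨27893⟩ — the vacuous direction (`A := 1`, `κ := 0`: a non-stationary periodic vortex line contradicts NoLoops applied to the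
re-parametrised orbit `θ ↦ c (θ + s₀)`), as in `Lines/noloops_wall.lean`. -/
theorem frequencyGrowthExponent_of_noLoops
    (h :
    ∀ (C : ℝ) (v : ℝ → EuclideanSpace ℝ (Fin 3) → EuclideanSpace ℝ (Fin 3)), Literature.Analysis.FluidPDE.HasTypeITimeDecay C v →
      ContinuousOn (Function.uncurry v) (Set.Iio (0 : ℝ) ×ˢ Set.univ) →
      (∀ s t : ℝ, s < t → t < 0 → ∀ x, v t x = Literature.Analysis.UnboundedOperators.heatExtension (v s) (t - s) x -
        Literature.Analysis.FluidPDE.oseenDuhamel 1 s v v t x) →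
      (∀ t < 0, Literature.Analysis.FluidPDE.VectorCalculus.IsDivFree (v t)) →
      (∀ s < 0, ∀ y, ⟪Literature.Analysis.FluidPDE.curl (v s) y, EuclideanSpace.single 2 1⟫_ℝ = 0) →
      ∀ s : ℝ, s < 0 → ∀ (γ : ℝ → EuclideanSpace ℝ (Fin 3)) (ℓ : ℝ), 0 < ℓ →
        (∀ θ, HasDerivAt γ (Literature.Analysis.FluidPDE.curl (v s) (γ θ)) θ) → (∀ θ, γ (θ + ℓ) = γ θ) →
        Literature.Analysis.FluidPDE.curl (v s) (γ 0) = 0) :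
    FrequencyGrowthExponent := by
  intro C v hd hc hm hdf hpol
  refine ⟨1, 0, one_pos, by norm_num, ?_⟩
  intro t₀ t _ht₀ ht c T hT hper hder hne
  obtain ⟨s₀, hs₀⟩ := hne
  exfalso
  apply hs₀
  have key := h C v hd hc hm hdf hpol t ht (fun θ => c (θ + s₀)) T hT
    (fun θ => (hder (θ + s₀)).comp_add_const θ s₀)
    (fun θ => by
      show c (θ + T + s₀) = c (θ + s₀)
      rw [add_right_comm]
      exact hper (θ + s₀))
  simpa using key

/-- ⟨27893⟩ ⇒ NoIslands — this IS the landed `…HotLoopsReduction.zero_of_island` (K2-p2 g11, p666322). -/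
theorem noIslands_of_frequencyGrowthExponent (hG : FrequencyGrowthExponent) :
    ∀ (C : ℝ) (v : ℝ → EuclideanSpace ℝ (Fin 3) → EuclideanSpace ℝ (Fin 3)),
      Literature.Analysis.FluidPDE.HasTypeITimeDecay C v →
      ContinuousOn (Function.uncurry v) (Set.Iio (0 : ℝ) ×ˢ Set.univ) →
      (∀ s t : ℝ, s < t → t < 0 → ∀ x, v t x =
        Literature.Analysis.UnboundedOperators.heatExtension (v s) (t - s) x -
          Literature.Analysis.FluidPDE.oseenDuhamel 1 s v v t x) →
      (∀ t < 0, Literature.Analysis.FluidPDE.VectorCalculus.IsDivFree (v t)) →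
      (∀ s < 0, ∀ y, ⟪Literature.Analysis.FluidPDE.curl (v s) y, EuclideanSpace.single 2 1⟫_ℝ = 0) →
      ∀ (s₀ z₁ σ M : ℝ) (K O : Set (EuclideanSpace ℝ (Fin 3))), s₀ < 0 →
        ((σ = 1 ∨ σ = -1) ∧ IsCompact K ∧ K.Nonempty ∧ (∀ y ∈ K, y 2 = z₁ ∧ σ * v s₀ y 2 = M) ∧
          IsOpen O ∧ K ⊆ O ∧ (∀ y ∈ O, y 2 = z₁ → σ * v s₀ y 2 ≤ M) ∧
          (∀ y ∈ O, y 2 = z₁ → σ * v s₀ y 2 = M → y ∈ K)) →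
        ∀ t < 0, ∀ x, v t x = 0 :=
  PoloidalWindowDoorPoloidalWindowRigidityHotLoopsReduction.zero_of_island hG

/-- **THE WALL IS A SCALAR WALL: ⟨27893⟩ `FrequencyGrowthExponent` ⟺ NoIslands**, sorry-free. -/
theorem frequencyGrowthExponent_iff_noIslands :
    FrequencyGrowthExponent ↔
    ∀ (C : ℝ) (v : ℝ → EuclideanSpace ℝ (Fin 3) → EuclideanSpace ℝ (Fin 3)),
      Literature.Analysis.FluidPDE.HasTypeITimeDecay C v →
      ContinuousOn (Function.uncurry v) (Set.Iio (0 : ℝ) ×ˢ Set.univ) →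
      (∀ s t : ℝ, s < t → t < 0 → ∀ x, v t x =
        Literature.Analysis.UnboundedOperators.heatExtension (v s) (t - s) x -
          Literature.Analysis.FluidPDE.oseenDuhamel 1 s v v t x) →
      (∀ t < 0, Literature.Analysis.FluidPDE.VectorCalculus.IsDivFree (v t)) →
      (∀ s < 0, ∀ y, ⟪Literature.Analysis.FluidPDE.curl (v s) y, EuclideanSpace.single 2 1⟫_ℝ = 0) →
      ∀ (s₀ z₁ σ M : ℝ) (K O : Set (EuclideanSpace ℝ (Fin 3))), s₀ < 0 →
        ((σ = 1 ∨ σ = -1) ∧ IsCompact K ∧ K.Nonempty ∧ (∀ y ∈ K, y 2 = z₁ ∧ σ * v s₀ y 2 = M) ∧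
          IsOpen O ∧ K ⊆ O ∧ (∀ y ∈ O, y 2 = z₁ → σ * v s₀ y 2 ≤ M) ∧
          (∀ y ∈ O, y 2 = z₁ → σ * v s₀ y 2 = M → y ∈ K)) →
        ∀ t < 0, ∀ x, v t x = 0 :=
  ⟨noIslands_of_frequencyGrowthExponent, fun hNI => frequencyGrowthExponent_of_noLoops (noLoops_of_noIslands hNI)⟩

/-- **NoLoops ⟺ NoIslands**, sorry-free: per class poloidal profile, closed vortex lines and planar hills of `v₂` come together. -/
theorem noLoops_iff_noIslands :
    (
    ∀ (C : ℝ) (v : ℝ → EuclideanSpace ℝ (Fin 3) → EuclideanSpace ℝ (Fin 3)), Literature.Analysis.FluidPDE.HasTypeITimeDecay C v →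
      ContinuousOn (Function.uncurry v) (Set.Iio (0 : ℝ) ×ˢ Set.univ) →
      (∀ s t : ℝ, s < t → t < 0 → ∀ x, v t x = Literature.Analysis.UnboundedOperators.heatExtension (v s) (t - s) x -
        Literature.Analysis.FluidPDE.oseenDuhamel 1 s v v t x) →
      (∀ t < 0, Literature.Analysis.FluidPDE.VectorCalculus.IsDivFree (v t)) →
      (∀ s < 0, ∀ y, ⟪Literature.Analysis.FluidPDE.curl (v s) y, EuclideanSpace.single 2 1⟫_ℝ = 0) →
      ∀ s : ℝ, s < 0 → ∀ (γ : ℝ → EuclideanSpace ℝ (Fin 3)) (ℓ : ℝ), 0 < ℓ →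
        (∀ θ, HasDerivAt γ (Literature.Analysis.FluidPDE.curl (v s) (γ θ)) θ) → (∀ θ, γ (θ + ℓ) = γ θ) →
        Literature.Analysis.FluidPDE.curl (v s) (γ 0) = 0) ↔
    ∀ (C : ℝ) (v : ℝ → EuclideanSpace ℝ (Fin 3) → EuclideanSpace ℝ (Fin 3)),
      Literature.Analysis.FluidPDE.HasTypeITimeDecay C v →
      ContinuousOn (Function.uncurry v) (Set.Iio (0 : ℝ) ×ˢ Set.univ) →
      (∀ s t : ℝ, s < t → t < 0 → ∀ x, v t x =
        Literature.Analysis.UnboundedOperators.heatExtension (v s) (t - s) x -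
          Literature.Analysis.FluidPDE.oseenDuhamel 1 s v v t x) →
      (∀ t < 0, Literature.Analysis.FluidPDE.VectorCalculus.IsDivFree (v t)) →
      (∀ s < 0, ∀ y, ⟪Literature.Analysis.FluidPDE.curl (v s) y, EuclideanSpace.single 2 1⟫_ℝ = 0) →
      ∀ (s₀ z₁ σ M : ℝ) (K O : Set (EuclideanSpace ℝ (Fin 3))), s₀ < 0 →
        ((σ = 1 ∨ σ = -1) ∧ IsCompact K ∧ K.Nonempty ∧ (∀ y ∈ K, y 2 = z₁ ∧ σ * v s₀ y 2 = M) ∧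
          IsOpen O ∧ K ⊆ O ∧ (∀ y ∈ O, y 2 = z₁ → σ * v s₀ y 2 ≤ M) ∧
          (∀ y ∈ O, y 2 = z₁ → σ * v s₀ y 2 = M → y ∈ K)) →
        ∀ t < 0, ∀ x, v t x = 0 :=
  ⟨fun h => noIslands_of_frequencyGrowthExponent (frequencyGrowthExponent_of_noLoops h), noLoops_of_noIslands⟩

end Summit.NavierStokesRegularity.NavierStokesRegularity.Theorems.PoloidalWindowDoorPoloidalWindowRigidityLoopIslandReduction
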